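import Summits.BirchSwinnertonDyer.BirchSwinnertonDyer.Theorems.PrintCf2RubinValueTwoRowTwoTwistedKummerClass
import Literature.NumberTheory.GaloisRepresentations.KummerGalFixing
import HarnessLib

/-!
# M-LINE-PIN / (α3) ROW 2, FILE 7a: EVERY class of `H¹(G_S(F), μ_{p^k} ⊗ θ′)` IS a twisted Kummer class (Hilbert 90 on `Gal(K̄/F)`)

Cell `bsd-print-cf2`, WIDTH seat `bsd-line-cf2-p1-w6` g9 (prover-bsd-line-cf2-p1-w6-g9-0), successor of g8 on (α3) ROW 2 of the JLK road on the
DECIDING child stmt-BirchSwinnertonDyer-24721 `PrintCf2RubinValueTwo.MainConjClauseAtSplitTwoQuadDA` (memo `HOME/bsd-line-cf2-p1-w6/ROW2-RHO3-SPEC-w6g9.md`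
§2 (C-a): the entry point of the COKERNEL half of ρ3); `--supports` that item (helper, Theses-free). HONEST FRAMING: Kummer theory = the tree's
`galFixing.exists_kummer_of_cocycle_charZero` (Hilbert 90, Serre X §3 b)) read in ty2's currency; nothing here closes the crux or a registered
stub; no summit statement is proved by this seat; BSD is not proved by any of this. THEOREMS ONLY (no definition, no named fact, no instance,
no `sorry`).

WHAT. For `U = Gal(K̄/F)` (`F/K` finite) with `θ′|_U = 1`: EVERY `y ∈ H¹(G_S(F), μ_{p^k} ⊗ θ′)` (ty2's `levelCoh p S θ′ (galFixing K F) k 1`) is a twisted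
Kummer class — `IsTwistedKummerClass p θ′ S (galFixing K F) k β y` for some `β ∈ K̄ˣ` with `β^{p^k} ∈ F` and `β` FIXED by `N_S ∩ Gal(K̄/F)` (the cocycle
is trivial on `N_S`). (`exists_isTwistedKummerClass_eq`.) So the units-side map of ROW 2 misses a class `y` only by (i) `β^{p^k} ∈ F^×` versus `ℰ(F)`
— measured by the `S`-valuations and by `Cl_S(F)[p^k]` (ROW2-RHO3-SPEC (C-a)–(C-c)) — and (ii) `cor_{F_n→K̃_n}` versus all of `H¹(G_S(K̃_n), ·)`
((C-d)). This file is (C-a)'s first half: surjectivity of Kummer theory onto `H¹` at the level of `F^× ∩ K_S^{×p^k}`.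

presearch: «H¹(G_F, μ_n) = F^×/F^{×n} (Hilbert 90 / Kummer)» → Serre, *Local Fields* X §3 b); tree `KummerGalFixing` (`galFixing.exists_kummer_of_cocycle`,
`_charZero`). beyond-print theorem: no.

References: J.-P. Serre, *Local Fields* (1979) X §3 b); J. Johnson-Leung, G. Kings, J. reine angew. Math. 653 (2011) §3.3, Cor. 3.4; J. Neukirch,
A. Schmidt, K. Wingberg, *Cohomology of Number Fields* VIII §3.
-/

noncomputable section

open scoped Classical

-- the summit namespace `Summit.BirchSwinnertonDyer.BirchSwinnertonDyer` repeats the problem name by design (D-0017)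
set_option linter.dupNamespace false
set_option autoImplicit false

open scoped NumberField
open Field IsDedekindDomain IntermediateField
open Literature.NumberTheory.GaloisRepresentations Literature.NumberTheory.GaloisRepresentations.DiscreteGaloisModule
open Literature.NumberTheory.GaloisRepresentations.LocalWeilDatum
open Literature.NumberTheory.ComplexMultiplication.EllipticUnits.JohnsonLeungKings2011

namespace Summit.BirchSwinnertonDyer.BirchSwinnertonDyer.Theorems.PrintCf2.RowTwo

variable {K : Type} [Field K] [NumberField K] (p : ℕ) [Fact p.Prime] (S : Set (HeightOneSpectrum (𝓞 K)))
  (θ : absoluteGaloisGroup K →ₜ* ℤ_[p]ˣ) (k : ℕ) (F : IntermediateField K (AlgebraicClosure K))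

/-- **EVERY CLASS OF `H¹(G_S(F), μ_{p^k} ⊗ θ′)` IS A TWISTED KUMMER CLASS** (`θ′|_{Gal(K̄/F)} = 1`): for every `y` there are `β ∈ K̄ˣ` and `b ∈ F` with
`b = β^{p^k}`, `β` fixed by every `τ ∈ N_S ∩ Gal(K̄/F)` (the cocycle vanishes on `N_S`), and `IsTwistedKummerClass p θ′ S (galFixing K F) k β y`. (The
cocycle `σ ↦ muVal (φ σ̄)` of a representative `φ` is a continuous crossed homomorphism `Gal(K̄/F) → μ_{p^k}` for the GALOIS action — the twist is
invisible on `Gal(K̄/F)` — and Hilbert 90 (`galFixing.exists_kummer_of_cocycle_charZero`) writes it as `σ ↦ σβ/β`.)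
[cite: SerreLocalFields1979, X §3 b)] [cite: JohnsonLeungKings2011, §3.3 (5)–(6), Cor. 3.4 (arXiv p0010:L40–70)] -/
theorem exists_isTwistedKummerClass_eq (hθF : ∀ σ ∈ galFixing K F, θ σ = 1) (y : levelCoh p S θ (galFixing K F) k 1) :
    ∃ (β : (AlgebraicClosure K)ˣ) (b : F), algebraMap F (AlgebraicClosure K) b = (β : AlgebraicClosure K) ^ (p ^ k) ∧
      (∀ τ ∈ ramificationSubgroup K S, τ ∈ galFixing K F → τ • β = β) ∧ IsTwistedKummerClass p θ S (galFixing K F) k β y := by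
  obtain ⟨φ₀, rfl⟩ := oneCocycleClass_surjective _ y
  let X := (coeffGS p S θ k).toTopRep
  let φ : contOneCocycles (subgroupRep X (imGS S (galFixing K F))) := φ₀
  -- the cocycle read on `Gal(K̄/F)` with values in `K̄ˣ`
  let ι : galFixing K F → imGS S (galFixing K F) := fun σ ↦ ⟨toUnramifiedQuot K S σ, Subgroup.mem_map_of_mem _ σ.2⟩
  have hιmul : ∀ g h : galFixing K F, ι (g * h) = ι g * ι h := fun g h ↦ Subtype.ext (map_mul _ _ _)
  have hιcont : Continuous ι := ((continuous_toUnramifiedQuot K S).comp continuous_subtype_val).subtype_mk _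
  let c : galFixing K F → (AlgebraicClosure K)ˣ := fun σ ↦ muVal K (p ^ k) ((φ.1 (ι σ) :
    Representation.invariants ((muTwist p θ k).toRepresentation.comp (ramificationSubgroup K S).subtype)) : MuCarrier K (p ^ k))
  have hρ : ∀ (g : galFixing K F) (w : X), muVal K (p ^ k) (((subgroupRep X (imGS S (galFixing K F))).ρ (ι g) w :
      Representation.invariants ((muTwist p θ k).toRepresentation.comp (ramificationSubgroup K S).subtype)) : MuCarrier K (p ^ k)) =
      (g : absoluteGaloisGroup K) • muVal K (p ^ k) ((w : Representation.invariants
        ((muTwist p θ k).toRepresentation.comp (ramificationSubgroup K S).subtype)) : MuCarrier K (p ^ k)) := by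
    intro g w
    rw [subgroupRep_ρ_apply]
    change muVal K (p ^ k) (muTwist p θ k (g : absoluteGaloisGroup K) _) = _
    rw [muTwist_apply_of_apply_eq_one p θ k (hθF _ g.2), muVal_apply]
    rfl
  have hcoc : ∀ g h, c (g * h) = c g * (g : absoluteGaloisGroup K) • c h := by
    intro g h
    change muVal K (p ^ k) ((φ.1 (ι (g * h)) : Representation.invariants
      ((muTwist p θ k).toRepresentation.comp (ramificationSubgroup K S).subtype)) : MuCarrier K (p ^ k)) = _
    rw [hιmul, φ.2 (ι g) (ι h), Submodule.coe_add, muVal_add, hρ]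
  have hopen : IsOpen {g | c g = 1} := by
    have h0 : {g | c g = 1} = (fun g ↦ φ.1 (ι g)) ⁻¹' {0} := by
      ext g
      simp only [Set.mem_setOf_eq, Set.mem_preimage, Set.mem_singleton_iff, c]
      rw [← muVal_zero K (p ^ k)]
      exact ⟨fun h ↦ Subtype.ext (muVal_injective K (p ^ k) h), fun h ↦ by rw [h]; rfl⟩
    rw [h0]
    exact (isOpen_discrete _).preimage (φ.1.continuous.comp hιcont)
  have hn : ∀ g, c g ^ (p ^ k) = 1 := fun g ↦ muVal_pow_eq_one K (p ^ k) _
  obtain ⟨β, b, hb, hβ⟩ := galFixing.exists_kummer_of_cocycle_charZero F (p ^ k) c hcoc hopen hn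
  refine ⟨β, b, hb, fun τ hτN hτF ↦ ?_, φ, rfl, fun σ hσ ↦ hβ ⟨σ, hσ⟩⟩
  -- `τ ∈ N_S`: `ι τ = 1`, so `τβ/β = c τ = muVal (φ 1) = 1`
  have h1 : ι ⟨τ, hτF⟩ = 1 := Subtype.ext ((QuotientGroup.eq_one_iff τ).mpr hτN)
  have h2 : c ⟨τ, hτF⟩ = 1 := by
    change muVal K (p ^ k) ((φ.1 (ι ⟨τ, hτF⟩) : Representation.invariants
      ((muTwist p θ k).toRepresentation.comp (ramificationSubgroup K S).subtype)) : MuCarrier K (p ^ k)) = 1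
    rw [h1, contOneCocycles.apply_one, Submodule.coe_zero, muVal_zero]
  rw [hβ ⟨τ, hτF⟩, div_eq_one] at h2
  exact h2

end Summit.BirchSwinnertonDyer.BirchSwinnertonDyer.Theorems.PrintCf2.RowTwo

end
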